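import Literature.Analysis.SpecialFunctions.ComplexGaussianDeterminant
import HarnessLib

/-!
# The pseudofermion (Petcher–Weingarten) Gaussian representation of `|det D|²`, the pseudofermion
# heat-bath, and the Knechtli–Wolff stochastic determinant-ratio acceptance

Topic `MathematicalPhysics/QuantumFieldTheory` (next to `Multiboson.lean`, Lüscher's bosonic
representation of INVERSE determinants).  PUBLISHED RESULTS, proved here as COROLLARIES of the
tree's discharged complex Gaussian integral
`Literature.Analysis.SpecialFunctions.complexGaussianIntegral_posDef_holds` /
`complexGaussianIntegral_normSq_of` (Altland–Simons (3.17)) and of its linear change of variables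
`integral_comp_mulVec` — no named fact is introduced (D-0026).  Wanted by the cell pub-lqcd
(venture `LatticeQCDFlow`, HOME/R2-SCOPE.md §1 "joint target with pseudofermions … whose
`U`-marginal is `p(U)`", §3 E2 route D1, §5 control X-5a; FANOUT row 38).

Sources and what is taken from each (finite-dimensional statements; `D`, `M` are invertible
complex `N × N` matrices, `∫ dη = ∏ᵢ d(Re ηᵢ) d(Im ηᵢ)` is Lebesgue measure on `ℂ^N`, which is
Mathlib's `volume` on `ι → ℂ`):

* Montvay–Münster, *Quantum Fields on a Lattice* (CUP 1994), §7.4 eq. (7.144)–(7.145), crediting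
  Petcher–Weingarten [7.32] = Weingarten–Petcher, Phys. Lett. B 99 (1981) 333:
  "`det(Q⁺Q) ∝ ∫ [dφ dφ⁺] exp{−Σ_{xy} (φ⁺_y [Q⁺Q]⁻¹_{yx} φ_x)}`" with
  "`{φ, [Q⁺Q]⁻¹φ} ≡ {Q⁺⁻¹φ, Q⁺⁻¹φ}`" — here with the constant made explicit:
  `∫ exp(−‖D⁻¹η‖²) dη = π^N |det D|²` (`integral_exp_neg_normSq_inv_mulVec`; take `D = Q⁺`,
  `|det Q⁺|² = det(Q⁺Q)`).
* Knechtli–Wolff, Nucl. Phys. B 663 (2003) 3, §4.1 "Stochastic estimation of fermion determinant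
  ratios", eqs. (4.1)–(4.9): "The fundamental formula is `∫ D[η] ρ(Mη) = |det M|⁻²`" (4.1) with
  `D[η] = ∏ d(Re η) d(Im η)/π`, `ρ(η) = exp[−η†η]` (`integral_gaussianMeasure_comp_mulVec`); "an
  unbiased estimate of the determinant … `|det M|⁻² = ⟨ρ(Mη)/ρ(η)⟩_η`" (4.5)
  (`stochasticRatio_mean`); for `w₀(A,A') = min[1, ρ(Mη)/ρ(η)]` (4.7) and the reverse move `M ↔ M⁻¹`,
  "`⟨w₀(A,A')⟩_η / ⟨w₀(A',A)⟩_η = ∫D[η] min[ρ(η),ρ(Mη)] / ∫D[η] min[ρ(η),ρ(M⁻¹η)] = |det M|⁻²`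
  shows detailed balance. The last equality follows by changing variables `η → Mη`" (4.8)
  (`integral_min_gaussian_mulVec`); the bound "`∫D[η] min[ρ(η),ρ(Mη)] ≤ min(1, |det M|⁻²)`" (4.9)
  (`integral_min_gaussian_mulVec_le`); and, for the record, the sentence after (4.9): "If we average
  under the min function, `N_η = 1` seems to be the only finite value for which detailed balance
  can be shown" (a finite witness that `N_η = 2` indeed fails is the venture file
  `Summits/Ventures/LatticeQCDFlow/Exactness/SharedNoiseAcceptance.lean`).
* Finkenrath–Knechtli–Leder, Comput. Phys. Commun. 184 (2013) 1522, App. A.2: the pseudofermion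
  heat-bath "`η = D(U) ξ`, where `ξ` is a Gaussian random pseudofermion generated with probability
  distribution `p(ξ) = exp(−|ξ|²)`" produces `P̂(η|U) = e^{−|D(U)⁻¹η|²}/|det D(U)|²`
  (`integral_gaussian_comp_mulVec_eq`: `E_ξ F(Dξ) = ∫ F(η) e^{−|D⁻¹η|²} dη / (π^N |det D|²)`), and
  "The equilibrium distribution of the gauge field alone is recovered by integrating over the
  pseudofermion: `P(U) = ∫ D[η] P̂(η, U)`" (`integral_exp_neg_normSq_inv_mulVec` again).

Lean reading: `‖D⁻¹η‖² = Σᵢ ‖(D⁻¹ *ᵥ η) i‖²`; `D⁻¹` is Mathlib's `Matrix` nonsingular inverse;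
`|det D|² = ‖D.det‖ ^ 2`.

## References
* [MontvayMunster1994] I. Montvay, G. Münster, Quantum Fields on a Lattice, CUP 1994, §7.4.
* [WeingartenPetcher1981] D. H. Weingarten, D. N. Petcher, Phys. Lett. B 99 (1981) 333.
* [KnechtliWolff2003] F. Knechtli, U. Wolff, Nucl. Phys. B 663 (2003) 3, §4.1.
* [FinkenrathKnechtliLeder2013] J. Finkenrath, F. Knechtli, B. Leder, CPC 184 (2013) 1522, App. A.
* [AltlandSimons2010] A. Altland, B. D. Simons, Condensed Matter Field Theory, CUP 2010, §3.2.
-/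

namespace Literature.MathematicalPhysics.QuantumFieldTheory.Pseudofermion

open MeasureTheory Matrix Literature.Analysis.SpecialFunctions
open scoped BigOperators

variable {ι : Type} [Fintype ι] [DecidableEq ι]

/-- `D⁻¹ (D ξ) = ξ` for `det D ≠ 0` (vector form; private helper). [folklore] -/
private theorem inv_mulVec_mulVec (D : Matrix ι ι ℂ) (hD : D.det ≠ 0) (ξ : ι → ℂ) :
    D⁻¹ *ᵥ (D *ᵥ ξ) = ξ := by
  rw [Matrix.mulVec_mulVec, Matrix.nonsing_inv_mul D (Ne.isUnit hD), Matrix.one_mulVec]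

/-- `D (D⁻¹ η) = η` for `det D ≠ 0` (vector form; private helper). [folklore] -/
private theorem mulVec_inv_mulVec (D : Matrix ι ι ℂ) (hD : D.det ≠ 0) (η : ι → ℂ) :
    D *ᵥ (D⁻¹ *ᵥ η) = η := by
  rw [Matrix.mulVec_mulVec, Matrix.mul_nonsing_inv D (Ne.isUnit hD), Matrix.one_mulVec]

/-- `det D⁻¹ = (det D)⁻¹` (private helper). [folklore] -/
private theorem det_inv_eq (D : Matrix ι ι ℂ) : D⁻¹.det = D.det⁻¹ := by
  rw [Matrix.det_nonsing_inv, Ring.inverse_eq_inv]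

/-- **Knechtli–Wolff's "fundamental formula"** `∫ D[η] ρ(Mη) = |det M|⁻²` with
`D[η] = ∏ d(Re η)d(Im η)/π` and `ρ(η) = e^{−η†η}`, written without the `1/π` normalisation:
`∫_{ℂ^N} e^{−‖Mη‖²} dη = π^N / |det M|²` — the tree's Altland–Simons corollary at `B = M`.
[cite: KnechtliWolff2003, §4.1 eq. (4.1) with the measure (4.2) and ρ of (4.4)];
[cite: AltlandSimons2010, §3.2 eq. (3.17)] -/
theorem integral_gaussianMeasure_comp_mulVec (M : Matrix ι ι ℂ) (hM : M.det ≠ 0) :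
    ∫ η : ι → ℂ, Real.exp (-(∑ i, ‖(M *ᵥ η) i‖ ^ 2)) =
      Real.pi ^ Fintype.card ι / ‖M.det‖ ^ 2 :=
  complexGaussianIntegral_normSq_of complexGaussianIntegral_posDef_holds ι M hM

/-- **The pseudofermion (Petcher–Weingarten) representation of `|det D|²`**:
`∫_{ℂ^N} exp(−‖D⁻¹η‖²) dη = π^N · |det D|²`.  With `D = Q⁺` this is Montvay–Münster (7.144),
"`det(Q⁺Q) ∝ ∫[dφ dφ⁺] exp{−(φ⁺[Q⁺Q]⁻¹φ)}`", via (7.145) "`{φ,[Q⁺Q]⁻¹φ} ≡ {Q⁺⁻¹φ, Q⁺⁻¹φ}`", with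
the proportionality constant `π^N` made explicit; equally Finkenrath–Knechtli–Leder's
"`P(U) = ∫ D[η] P̂(η,U)`" for `P̂(η,U) ∝ e^{−|D(U)⁻¹η|²}`.
[cite: MontvayMunster1994, §7.4 eq. (7.144)–(7.145)]; [cite: WeingartenPetcher1981, main result
(via MontvayMunster1994 ref. [7.32])]; [cite: FinkenrathKnechtliLeder2013, App. A.2 (the displays
for P̂(η,U), D[η] and P(U) = ∫D[η] P̂(η,U))] -/
theorem integral_exp_neg_normSq_inv_mulVec (D : Matrix ι ι ℂ) (hD : D.det ≠ 0) :
    ∫ η : ι → ℂ, Real.exp (-(∑ i, ‖(D⁻¹ *ᵥ η) i‖ ^ 2)) =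
      Real.pi ^ Fintype.card ι * ‖D.det‖ ^ 2 := by
  have hD' : D⁻¹.det ≠ 0 := by rw [det_inv_eq]; exact inv_ne_zero hD
  rw [integral_gaussianMeasure_comp_mulVec D⁻¹ hD', det_inv_eq, norm_inv, inv_pow, div_inv_eq_mul]

/-- **The pseudofermion heat-bath** `η = Dξ`, `ξ ∼ e^{−|ξ|²} dξ/π^N`: for every observable `F`,
`∫ e^{−‖ξ‖²} F(Dξ) dξ = |det D|⁻² ∫ e^{−‖D⁻¹η‖²} F(η) dη`, i.e. `η` is distributed with the
normalised density `e^{−|D⁻¹η|²} / (π^N |det D|²)` (Finkenrath–Knechtli–Leder's `P̂(η|U)`; the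
linear substitution has Jacobian `|det D|²` on `ℂ^N ≅ ℝ^{2N}`).
[cite: FinkenrathKnechtliLeder2013, App. A.2 (the displays for P̂(η|U) and η = D(U)ξ)];
[cite: KnechtliWolff2003, §4.1, sentence after eq. (4.4) ("The determinant appears as a Jacobian
in (4.1) for arbitrary ρ")] -/
theorem integral_gaussian_comp_mulVec_eq (D : Matrix ι ι ℂ) (hD : D.det ≠ 0)
    (F : (ι → ℂ) → ℝ) :
    ∫ ξ : ι → ℂ, Real.exp (-(∑ i, ‖ξ i‖ ^ 2)) * F (D *ᵥ ξ) =
      (‖D.det‖ ^ 2)⁻¹ * ∫ η : ι → ℂ, Real.exp (-(∑ i, ‖(D⁻¹ *ᵥ η) i‖ ^ 2)) * F η := by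
  have key := integral_comp_mulVec D hD (fun η => Real.exp (-(∑ i, ‖(D⁻¹ *ᵥ η) i‖ ^ 2)) * F η)
  simp only [inv_mulVec_mulVec D hD] at key
  rw [key, Complex.normSq_eq_norm_sq]

/-- **The stochastic determinant-ratio estimator is unbiased** (Knechtli–Wolff
"`|det M|⁻² = ⟨ρ(Mη)/ρ(η)⟩_η`", Gaussian `ρ`): `π^{−N} ∫ e^{−‖η‖²} · (e^{−‖Mη‖²}/e^{−‖η‖²}) dη = |det M|⁻²`.
[cite: KnechtliWolff2003, §4.1 eq. (4.5)] -/
theorem stochasticRatio_mean (M : Matrix ι ι ℂ) (hM : M.det ≠ 0) :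
    (Real.pi ^ Fintype.card ι)⁻¹ * ∫ η : ι → ℂ, Real.exp (-(∑ i, ‖η i‖ ^ 2)) *
        (Real.exp (-(∑ i, ‖(M *ᵥ η) i‖ ^ 2)) / Real.exp (-(∑ i, ‖η i‖ ^ 2))) =
      (‖M.det‖ ^ 2)⁻¹ := by
  have h : ∀ η : ι → ℂ, Real.exp (-(∑ i, ‖η i‖ ^ 2)) *
      (Real.exp (-(∑ i, ‖(M *ᵥ η) i‖ ^ 2)) / Real.exp (-(∑ i, ‖η i‖ ^ 2))) =
      Real.exp (-(∑ i, ‖(M *ᵥ η) i‖ ^ 2)) := fun η =>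
    mul_div_cancel₀ _ (Real.exp_pos _).ne'
  simp_rw [h]
  rw [integral_gaussianMeasure_comp_mulVec M hM, div_eq_mul_inv, ← mul_assoc,
    inv_mul_cancel₀ (pow_ne_zero _ Real.pi_pos.ne'), one_mul]

/-- **Knechtli–Wolff's detailed-balance identity for the one-pseudofermion stochastic acceptance**
`w₀(A,A') = min[1, ρ(Mη)/ρ(η)]`, reverse move `M ↔ M⁻¹`:
`∫ min[ρ(η), ρ(Mη)] dη = |det M|⁻² ∫ min[ρ(η), ρ(M⁻¹η)] dη` ("shows detailed balance. The last
equality follows by changing variables `η → Mη`").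
[cite: KnechtliWolff2003, §4.1 eqs. (4.6)–(4.8)];
[cite: FinkenrathKnechtliLeder2013, App. A.2 (property "P_acc(U,U')/P_acc(U',U) = |det M|⁻²")] -/
theorem integral_min_gaussian_mulVec (M : Matrix ι ι ℂ) (hM : M.det ≠ 0) :
    ∫ η : ι → ℂ, min (Real.exp (-(∑ i, ‖η i‖ ^ 2))) (Real.exp (-(∑ i, ‖(M *ᵥ η) i‖ ^ 2))) =
      (‖M.det‖ ^ 2)⁻¹ * ∫ η : ι → ℂ,
        min (Real.exp (-(∑ i, ‖η i‖ ^ 2))) (Real.exp (-(∑ i, ‖(M⁻¹ *ᵥ η) i‖ ^ 2))) := by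
  have hM' : M⁻¹.det ≠ 0 := by rw [det_inv_eq]; exact inv_ne_zero hM
  -- change variables `η → M⁻¹ η` in the right-hand integral
  have key := integral_comp_mulVec M⁻¹ hM'
    (fun w => min (Real.exp (-(∑ i, ‖(M *ᵥ w) i‖ ^ 2))) (Real.exp (-(∑ i, ‖w i‖ ^ 2))))
  simp only [mulVec_inv_mulVec M hM] at key
  rw [key, det_inv_eq, Complex.normSq_eq_norm_sq, norm_inv, inv_pow, inv_inv, ← mul_assoc,
    inv_mul_cancel₀ (pow_ne_zero _ (norm_ne_zero_iff.mpr hM)), one_mul]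
  exact integral_congr_ae (Filter.Eventually.of_forall fun η => min_comm _ _)

omit [DecidableEq ι] in
/-- The Gaussian weight `e^{−‖η‖²}` is integrable on `ℂ^N` (its integral is `π^N ≠ 0`; private
helper). [folklore] -/
private theorem integrable_exp_neg_sum_normSq :
    Integrable (fun η : ι → ℂ => Real.exp (-(∑ i, ‖η i‖ ^ 2))) := by
  refine Integrable.of_integral_ne_zero ?_
  rw [integral_rexp_neg_sum_normSq]
  exact pow_ne_zero _ Real.pi_pos.ne'

/-- The Gaussian weight `e^{−‖Mη‖²}` is integrable on `ℂ^N` for invertible `M` (its integral is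
`π^N/|det M|² ≠ 0`; private helper). [folklore] -/
private theorem integrable_exp_neg_sum_normSq_mulVec (M : Matrix ι ι ℂ) (hM : M.det ≠ 0) :
    Integrable (fun η : ι → ℂ => Real.exp (-(∑ i, ‖(M *ᵥ η) i‖ ^ 2))) := by
  refine Integrable.of_integral_ne_zero ?_
  rw [integral_gaussianMeasure_comp_mulVec M hM]
  exact div_ne_zero (pow_ne_zero _ Real.pi_pos.ne') (pow_ne_zero _ (norm_ne_zero_iff.mpr hM))

/-- **Knechtli–Wolff's "Carnot" bound**: the one-pseudofermion stochastic acceptance never exceeds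
the exact-determinant Metropolis acceptance, `∫D[η] min[ρ(η), ρ(Mη)] ≤ min(1, |det M|⁻²)` — here
without the `1/π^N` normalisation: `∫ min(e^{−‖η‖²}, e^{−‖Mη‖²}) dη ≤ min(π^N, π^N/|det M|²)`.
[cite: KnechtliWolff2003, §4.1 eq. (4.9)] -/
theorem integral_min_gaussian_mulVec_le (M : Matrix ι ι ℂ) (hM : M.det ≠ 0) :
    ∫ η : ι → ℂ, min (Real.exp (-(∑ i, ‖η i‖ ^ 2))) (Real.exp (-(∑ i, ‖(M *ᵥ η) i‖ ^ 2))) ≤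
      min (Real.pi ^ Fintype.card ι) (Real.pi ^ Fintype.card ι / ‖M.det‖ ^ 2) := by
  have hf := integrable_exp_neg_sum_normSq (ι := ι)
  have hg := integrable_exp_neg_sum_normSq_mulVec M hM
  have hmin : Integrable (fun η : ι → ℂ =>
      min (Real.exp (-(∑ i, ‖η i‖ ^ 2))) (Real.exp (-(∑ i, ‖(M *ᵥ η) i‖ ^ 2)))) := hf.inf hg
  refine le_min ?_ ?_
  · calc _ ≤ ∫ η : ι → ℂ, Real.exp (-(∑ i, ‖η i‖ ^ 2)) :=
          integral_mono hmin hf fun η => min_le_left _ _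
      _ = Real.pi ^ Fintype.card ι := integral_rexp_neg_sum_normSq
  · calc _ ≤ ∫ η : ι → ℂ, Real.exp (-(∑ i, ‖(M *ᵥ η) i‖ ^ 2)) :=
          integral_mono hmin hg fun η => min_le_right _ _
      _ = Real.pi ^ Fintype.card ι / ‖M.det‖ ^ 2 := integral_gaussianMeasure_comp_mulVec M hM

end Literature.MathematicalPhysics.QuantumFieldTheory.Pseudofermion
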